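import Summits.ResolutionOfSingularities.ResolutionOfSingularities.Theorems.HomologicalConductorNoZenoRQuadraticTransformStages
import Summits.ResolutionOfSingularities.ResolutionOfSingularities.Theorems.HomologicalConductorNoZenoRMinimalResolutionGlobal
import Literature.AlgebraicGeometry.Resolution.AffineBlowupUnique
import Literature.AlgebraicGeometry.Resolution.BlowupsExistence
import HarnessLib

/-!
# Crux `NoZenoR` (stmt-ResolutionOfSingularities-19943) — the GLOBAL inductive step of Lipman's proof of Theorem (4.1):
# a desingularization `X → W` of a stage factors through the blowing up of `W` at a non-regular normal point

Route `ResolutionOfSingularities/HomologicalConductor` (cell decomp-res, hand leafhand-res-homologicalconduct-21 g0).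
OURS: AI-written proof over tree theorems, weaker than expert review; nothing here is a statement of the manuscript
under review (Hironaka 2017).  SUPPORT level, counted 0.  Def-free, FACT-FREE.

Lipman, proof of Theorem (4.1) (p. 204): "Now, blow up a singular point on `Y` (if there is one).  Then blow up a
singular point on the resulting surface.  Continue in this way. … (*) (§2) shows that for every desingularization
`f′ : X′ → Y`, `X′` dominates `X`."  The local statement (*) at a stage (`…NoZenoRQuadraticTransformStages`:
over `Spec 𝒪_{W,w}` the base-changed desingularization factors through `Bl_{𝔪_w}`) is globalised here along the
pro-open immersion `Spec 𝒪_{W,w} → W` (Temkin 2008, §2.1), exactly as hand 16 g4 globalised minimality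
(`GlobalResolution.exists_isMinimalResolution_isBlowup_of_local`): for `S` a two-dimensional normal Noetherian local
domain with a rational singularity, `W` integral Noetherian, `g : W → Spec S` birational, locally of finite type,
quasi-compact and separated (a STAGE), `σ : X → W` a resolution, and `w ∈ W` a closed point whose local ring is a
normal domain of dimension `2` which is NOT regular:

* `exists_centre_isEffectiveCartier_comap_of_stage` — there is an ideal sheaf `𝓙 ≠ 0` on `W`, cosupported in `{w}`
  and restricting to the maximal ideal `𝔪̃_w` on `Spec 𝒪_{W,w}` (`𝓙·𝒪_{Spec 𝒪_{W,w}} = affineBlowup.idealSheaf 𝔪_w`; the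
  extension of Temkin's Lemma 2.1.1, tree `GlobalResolution.exists_comap_fromSpecStalk_eq`), whose inverse image
  `𝓙·𝒪_X` is an EFFECTIVE CARTIER DIVISOR: at points over `w` its stalks are those of `𝔪_w·𝒪_{X ×_W Spec 𝒪_{W,w}}`
  (isomorphic local rings along `X ×_W Spec 𝒪_{W,w} → X`, `isIso_stalkMap_pullback_fst_fromSpecStalk`), which is
  invertible by (*) at the stage (`isEffectiveCartier_baseIdeal_maximalIdeal_stalk_of_stage`); elsewhere it is the
  unit ideal;
* **`exists_isResolution_fac_blowup_of_stage`** — hence **`σ` factors through the blowing up `b : W₂ → W` of `W`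
  along `𝓙` (a blowing up "of the point `w`"), and the factor `τ : X → W₂` is again a resolution** (`τ ≫ b = σ`;
  tree `exists_isBlowup`, `IsResolution.exists_factor_of_isEffectiveCartier_comap`).  `W₂ → Spec S` is the next stage.

What remains for print `Lipman1969_4_1` on this route: Prop. (8.1) (normality of the new stage at its points over
`w` — needed to re-apply the step; XL) or a finite normalisation, and termination (exceptional-curve count).  No crux,
kill test or summit statement is proved here; resolution in positive characteristic is NOT proved.

References: J. Lipman, Publ. Math. IHÉS 36 (1969): §2 (*) (p. 203), Thm. (4.1) and proof (pp. 204–205) [`Lipman1969`];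
M. Temkin, Adv. Math. 219 (2008), §2.1, Lemma 2.1.1 [`Temkin2008`]; U. Görtz, T. Wedhorn, *Algebraic Geometry I* (2020),
Def. 13.90, Prop. 13.91 [`GortzWedhorn2020`].
-/

noncomputable section

-- single-problem summit: the doubled namespace component `ResolutionOfSingularities` is forced
set_option linter.dupNamespace false

open CategoryTheory CategoryTheory.Limits AlgebraicGeometry TopologicalSpace Opposite IsLocalRing
open Literature.AlgebraicGeometry.Morphisms Literature.AlgebraicGeometry.Modules
open Literature.AlgebraicGeometry.Resolution

namespace Summit.ResolutionOfSingularities.ResolutionOfSingularities.Theorems.NoZeno.QuadraticTransform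

variable {S : Type} [CommRing S] [IsNoetherianRing S] [IsLocalRing S] [IsDomain S] [IsIntegrallyClosed S]
  {W : Scheme.{0}} [IsIntegral W] (g : W ⟶ Spec (.of S)) [LocallyOfFiniteType g] [QuasiCompact g]
  [IsSeparated g] {X : Scheme.{0}} (σ : X ⟶ W)

omit [IsIntegral W] in
/-- The ideal sheaf `𝔪̃` of the maximal ideal on `Spec` of a local ring is cosupported at the closed point. [folklore] -/
theorem support_affineBlowupIdealSheaf_maximalIdeal_subset (w : W) :
    ((affineBlowup.idealSheaf (maximalIdeal (W.presheaf.stalk w))).support :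
      Set (Spec (.of (W.presheaf.stalk w)))) ⊆ {closedPoint (W.presheaf.stalk w)} := by
  rw [affineBlowup.support_idealSheaf]
  intro p hp
  have hp' : ((maximalIdeal (W.presheaf.stalk w) : Ideal (W.presheaf.stalk w)) : Set (W.presheaf.stalk w)) ⊆
      (p.asIdeal : Set (W.presheaf.stalk w)) := hp
  have h := (IsLocalRing.maximalIdeal.isMaximal (W.presheaf.stalk w)).eq_of_le p.2.ne_top
    (SetLike.coe_subset_coe.mp hp')
  exact PrimeSpectrum.ext h.symm

/-- A point with two-dimensional local ring is not the generic point (whose local ring is a field). [folklore] -/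
theorem ne_genericPoint_of_ringKrullDim_stalk_eq_two {w : W} (hw2 : ringKrullDim (W.presheaf.stalk w) = 2) :
    w ≠ genericPoint W := by
  intro h
  subst h
  have h0 : ringKrullDim (W.functionField) = 0 := ringKrullDim_eq_zero_of_isField (Field.toIsField _)
  change ringKrullDim (W.presheaf.stalk (genericPoint W)) = 0 at h0
  exact absurd (hw2.symm.trans h0) (by decide)

/-- **The global inductive step, centre form.**  See the module docstring.
[cite: Lipman1969, Theorem (4.1), proof (p. 204); Section 2, (*) (p. 203)] [cite: Temkin2008, Lemma 2.1.1] -/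
theorem exists_centre_isEffectiveCartier_comap_of_stage [IsNoetherian W] [IsNoetherian X]
    (hdim : ringKrullDim S = 2) (hrat : HasRationalSingularity S) (hg : IsBirational g) (hσ : IsResolution σ)
    (w : W) (hwc : IsClosed ({w} : Set W)) (hw : IsIntegrallyClosed (W.presheaf.stalk w))
    (hw2 : ringKrullDim (W.presheaf.stalk w) = 2) (hwsing : ¬ IsRegularLocalRing (W.presheaf.stalk w)) :
    ∃ J : W.IdealSheafData, (J.support : Set W) ⊆ {w} ∧
      J.comap (W.fromSpecStalk w) = affineBlowup.idealSheaf (maximalIdeal (W.presheaf.stalk w)) ∧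
      J ≠ ⊥ ∧ IsEffectiveCartier (J.comap σ) := by
  haveI : IsIntegral X := hσ.isIntegral_source
  haveI : IsDominant σ := hσ.isBirational.isDominant
  have hwgen : w ≠ genericPoint W := ne_genericPoint_of_ringKrullDim_stalk_eq_two hw2
  -- the centre: Temkin's extension of `𝔪̃_w` from `Spec 𝒪_{W,w}`
  obtain ⟨J, hJ, hJsupp⟩ := GlobalResolution.exists_comap_fromSpecStalk_eq w hwc
    (affineBlowup.idealSheaf (maximalIdeal (W.presheaf.stalk w))) (support_affineBlowupIdealSheaf_maximalIdeal_subset w)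
  -- `𝓙 ≠ 0` and `𝓙·𝒪_X ≠ 0`: the generic points lie off `{w}`
  have hJ0 : J ≠ ⊥ := by
    intro h
    have hmem : genericPoint W ∈ (J.support : Set W) := by
      rw [h, Scheme.IdealSheafData.support_bot]; trivial
    exact hwgen (hJsupp hmem).symm
  have hJσ0 : J.comap σ ≠ ⊥ := by
    intro h
    have hmem : genericPoint X ∈ ((J.comap σ).support : Set X) := by
      rw [h, Scheme.IdealSheafData.support_bot]; trivial
    rw [Scheme.IdealSheafData.support_comap] at hmem
    have h1 : σ (genericPoint X) = genericPoint W := genericPoint_eq_of_isDominant σ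
    have h2 : σ (genericPoint X) = w := hJsupp hmem
    exact hwgen (h2.symm.trans h1)
  -- (*) at the stage: `𝔪_w·𝒪` is an effective Cartier divisor on `X ×_W Spec 𝒪_{W,w}`
  have hB := isEffectiveCartier_baseIdeal_maximalIdeal_stalk_of_stage g σ hdim hrat hg hσ w hw hw2 hwsing
  have hB' : IsEffectiveCartier ((affineBlowup.idealSheaf (maximalIdeal (W.presheaf.stalk w))).comap
      (pullback.snd σ (W.fromSpecStalk w))) := by
    rw [ExcCount.comap_affineBlowupIdealSheaf_eq_baseIdeal]
    exact hB
  -- `𝓙·𝒪_X` is locally principal: transport along the pro-open `X ×_W Spec 𝒪_{W,w} → X`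
  have hLP : IsLocallyPrincipal (J.comap σ) := by
    intro z
    by_cases hz : σ z = w
    · obtain ⟨s, hs⟩ := mem_range_pullback_fst_fromSpecStalk_of_eq σ w (x' := z) hz
      haveI := isIso_stalkMap_pullback_fst_fromSpecStalk σ w s
      rw [isLocallyPrincipalAt_iff_isPrincipal_stalkIdeal, ← hs]
      refine GlobalResolution.isPrincipal_stalkIdeal_of_comap_of_isIso_stalkMap
        (pullback.fst σ (W.fromSpecStalk w)) (J.comap σ) s ?_
      rw [← Scheme.IdealSheafData.comap_comp, pullback.condition, Scheme.IdealSheafData.comap_comp, hJ]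
      exact (hB'.isLocallyPrincipal s).isPrincipal_stalkIdeal
    · refine isLocallyPrincipalAt_of_not_mem_support fun h => hz (hJsupp ?_)
      rw [Scheme.IdealSheafData.support_comap] at h
      exact h
  exact ⟨J, hJsupp, hJ, hJ0, hLP.isEffectiveCartier_of_ne_bot hJσ0⟩

/-- **The global inductive step of Lipman's proof of Theorem (4.1)**: `σ : X → W` factors through a blowing up
`b : W₂ → W` of `W` along a centre `𝓙 ≠ 0` cosupported at the non-regular normal point `w` (with
`𝓙·𝒪_{Spec 𝒪_{W,w}} = 𝔪̃_w`), and the factor `τ : X → W₂` is a resolution of the new stage `W₂`.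
[cite: Lipman1969, Theorem (4.1), proof (pp. 204–205); Section 2, (*) (p. 203)] -/
theorem exists_isResolution_fac_blowup_of_stage [IsNoetherian W] [IsNoetherian X]
    (hdim : ringKrullDim S = 2) (hrat : HasRationalSingularity S) (hg : IsBirational g) (hσ : IsResolution σ)
    (w : W) (hwc : IsClosed ({w} : Set W)) (hw : IsIntegrallyClosed (W.presheaf.stalk w))
    (hw2 : ringKrullDim (W.presheaf.stalk w) = 2) (hwsing : ¬ IsRegularLocalRing (W.presheaf.stalk w)) :
    ∃ (J : W.IdealSheafData) (W₂ : Scheme.{0}) (b : W₂ ⟶ W) (τ : X ⟶ W₂),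
      (J.support : Set W) ⊆ {w} ∧
      J.comap (W.fromSpecStalk w) = affineBlowup.idealSheaf (maximalIdeal (W.presheaf.stalk w)) ∧ J ≠ ⊥ ∧
      IsBlowup b J ∧ τ ≫ b = σ ∧ IsResolution τ := by
  obtain ⟨J, hJsupp, hJ, hJ0, hcart⟩ :=
    exists_centre_isEffectiveCartier_comap_of_stage g σ hdim hrat hg hσ w hwc hw hw2 hwsing
  obtain ⟨W₂, b, hb⟩ := exists_isBlowup W J
  obtain ⟨τ, hτ, hprop, hbir⟩ := hσ.exists_factor_of_isEffectiveCartier_comap hJ0 hb hcart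
  exact ⟨J, W₂, b, τ, hJsupp, hJ, hJ0, hb, hτ, ⟨hprop, hbir, hσ.isRegular⟩⟩

end Summit.ResolutionOfSingularities.ResolutionOfSingularities.Theorems.NoZeno.QuadraticTransform

end
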